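import HarnessLib
import Summits.ValiantsHypothesis.ValiantsHypothesis.Theorems.EquivariantDialLayersSymmetrisers

/-!
# Equivariant dial, layered face — point-stabiliser double sums of quadrics land in `𝔠_m`   [this file]

Companion of `EquivariantDialLayersSymmetrisers` (cell `A = EqHardBiPerm`, item `stmt-ValiantsHypothesis-23702`, draft route `SymmetryDial`,
layered leaf `R^lay`, step `[I1]` of `[I1] → [I2] → [I3]`).  HONEST FRAMING: `VP ≠ VNP` is NOT proved here, nor `A`, nor `R^lay`, nor any width
inequality; `[I2]` (type list of `R_2` via the Literature Pieri rule) and `[I3]` (assembly with `EquivariantDialLayersBlockWitness`) are NOT in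
this file.  What is certified, for every quadric `v` (`IsHomogeneous v 2`) and all `i, j < m`:
* `stabSym_mem_cheapIdeal`: `∑_{σ i = i} ∑_{τ j = j} (σ × τ) · v ∈ 𝔠_m` (the type `(m-1,1) ⊠ (m-1,1)` at symmetriser level);
* `sum_fixedCard_smul_rename_mem_cheapIdeal` (and `…_inv_…`): `∑_{(σ,τ)} (#fix σ - 1)(#fix τ - 1) • (σ × τ) · v ∈ 𝔠_m` — since
  `χ^{(m-1,1)}(σ) = #fix σ - 1`, this is the isotypic projector of `(m-1,1) ⊠ (m-1,1)` applied to `v`, up to its nonzero constant.  Together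
  with the full row/column symmetrisers of the companion file: the cheap isotypic component of `R_2` lies in `𝔠_m ∩ R_2` — `⊇` ONLY:
  `𝔠_m ∩ R_2` is STRICTLY LARGER than the cheap isotypic component (it also contains one copy each of `S⊠P, P⊠S, S⊠Q, Q⊠S`, `S = (m-1,1)`,
  `P = (m-2,2)`, `Q = (m-2,1,1)`; lineage instrument, `m = 4..7`), and `span(C_m) = component` is NOT claimed.  RESTATED `[I3]` TARGET (NOT
  proved here): every `𝔖_m × 𝔖_m`-stable `V ⊆ R_2` with `per_m ∈ (V)` has an irreducible constituent `W` with `W ∩ (𝔠_m ∩ R_2) = 0`, hence of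
  non-cheap type, hence `dim V ≥ (m-1)m(m-3)/2` for `m = pq`, `p, q ≥ 3` (`216` at `m = 9`).
MECHANISM [folklore orbit-sum / averaging identities over `ℂ` (char 0 used: division by `m - 2`)].  The column-stabiliser average
`A_j = ∑_{τ j = j} (1 × τ)` of a quadric monomial is computed EXACTLY modulo `𝔠_m`: it is congruent to a scalar multiple of `x_{a,j} x_{c,j}`
(`colAvg_stab_X_mul_X`; five cases, the generic one by the averaging trick over the free column `d' ∉ {b, j}`), and the row-stabiliser average
then kills `x_{a,j} x_{c,j}` (transpose of the same computation, the residue being a multiple of the square `x_{j,i}²`).  Packaging: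
`#fix σ • F σ = ∑_i ∑_{σ i = i} F σ` (`sum_fixedCard_smul_eq`).  0 named facts, 0 `def … : Prop`, 0 instances, 0 sorry, 0 data definitions.
-/

set_option linter.dupNamespace false

namespace Summit.ValiantsHypothesis.ValiantsHypothesis.Theorems.EquivariantDialLayersStabilisers

open MvPolynomial
open Equiv (Perm)
open Summit.ValiantsHypothesis.ValiantsHypothesis.Theorems.EquivariantDialLayersBlockWitness
open Summit.ValiantsHypothesis.ValiantsHypothesis.Theorems.EquivariantDialLayersSymmetrisers

variable {m : ℕ}

/-- `A_j` is unchanged by right translation of the argument by a column permutation fixing `j`. -/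
theorem colAvg_stab_rename_eq {j : Fin m} {π : Perm (Fin m)} (hπ : π j = j) (f : MvPolynomial (Fin m × Fin m) ℂ) :
    colAvg (stab j) (rename (Equiv.prodCongr (1 : Perm (Fin m)) π) f) = colAvg (stab j) f :=
  colAvg_rename_eq _ _ (fun τ => by rw [mem_stab, mem_stab, Equiv.Perm.mul_apply, hπ]) f

/-- Both columns equal to `j`: `A_j(x_{a,j} x_{c,j}) = #Stab(j) • x_{a,j} x_{c,j}`. -/
theorem colAvg_stab_fixed (j a c : Fin m) :
    colAvg (stab j) (X (a, j) * X (c, j)) = (stab j).card • (X (a, j) * X (c, j) : MvPolynomial (Fin m × Fin m) ℂ) := by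
  rw [colAvg_apply, ← Finset.sum_const]
  refine Finset.sum_congr rfl fun τ hτ => ?_
  rw [map_mul, rename_one_prodCongr_X, rename_one_prodCongr_X, mem_stab.1 hτ]

/-- Equal free columns `b = d ≠ j`: `A_j(x_{a,b} x_{c,b}) = N • (XXᵀ)_{a,c} - N • x_{a,j} x_{c,j}`. -/
theorem colAvg_stab_same {j b : Fin m} (hb : b ≠ j) (a c : Fin m) :
    colAvg (stab j) (X (a, b) * X (c, b)) =
      ((stab j).filter fun τ => τ b = b).card • rowGram (Fin m) a c -
        ((stab j).filter fun τ => τ b = b).card • (X (a, j) * X (c, j) : MvPolynomial (Fin m × Fin m) ℂ) := by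
  rw [colAvg_apply]
  simp_rw [map_mul, rename_one_prodCongr_X]
  show ∑ τ ∈ stab j, (fun l => (X (a, l) * X (c, l) : MvPolynomial (Fin m × Fin m) ℂ)) (τ b) = _
  rw [sum_stab_apply_eq_card_smul hb (fun l => (X (a, l) * X (c, l) : MvPolynomial (Fin m × Fin m) ℂ)),
    Finset.sum_erase_eq_sub (Finset.mem_univ j), smul_sub]
  rfl

/-- Left column fixed, `d ≠ j`: `A_j(x_{a,j} x_{c,d}) = N • x_{a,j} t_c - N • x_{a,j} x_{c,j}`. -/
theorem colAvg_stab_left {j d : Fin m} (hd : d ≠ j) (a c : Fin m) :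
    colAvg (stab j) (X (a, j) * X (c, d)) =
      ((stab j).filter fun τ => τ d = d).card • (X (a, j) * rowSum (Fin m) c) -
        ((stab j).filter fun τ => τ d = d).card • (X (a, j) * X (c, j) : MvPolynomial (Fin m × Fin m) ℂ) := by
  rw [colAvg_mul_of_forall_rename_eq (f := (X (a, j) : MvPolynomial (Fin m × Fin m) ℂ)) (stab j)
    (fun τ hτ => by rw [rename_one_prodCongr_X, mem_stab.1 hτ]), colAvg_apply]
  simp_rw [rename_one_prodCongr_X]
  show X (a, j) * ∑ τ ∈ stab j, (fun l => (X (c, l) : MvPolynomial (Fin m × Fin m) ℂ)) (τ d) = _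
  rw [sum_stab_apply_eq_card_smul hd (fun l => (X (c, l) : MvPolynomial (Fin m × Fin m) ℂ)),
    Finset.sum_erase_eq_sub (Finset.mem_univ j), smul_sub, mul_sub, mul_smul_comm, mul_smul_comm]
  rfl

/-- Right column fixed, `b ≠ j`: `A_j(x_{a,b} x_{c,j}) = N • x_{c,j} t_a - N • x_{a,j} x_{c,j}`. -/
theorem colAvg_stab_right {j b : Fin m} (hb : b ≠ j) (a c : Fin m) :
    colAvg (stab j) (X (a, b) * X (c, j)) =
      ((stab j).filter fun τ => τ b = b).card • (X (c, j) * rowSum (Fin m) a) -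
        ((stab j).filter fun τ => τ b = b).card • (X (a, j) * X (c, j) : MvPolynomial (Fin m × Fin m) ℂ) := by
  rw [mul_comm, colAvg_stab_left hb c a, mul_comm (X (c, j)) (X (a, j))]

/-- The column-stabiliser average of a quadric monomial is a scalar multiple of `x_{a,j} x_{c,j}` modulo `𝔠_m`. -/
theorem colAvg_stab_X_mul_X (j a b c d : Fin m) : ∃ α : ℂ,
    colAvg (stab j) (X (a, b) * X (c, d)) - α • (X (a, j) * X (c, j)) ∈ cheapIdeal (Fin m) := by
  by_cases hb : b = j
  · rw [hb]
    by_cases hd : d = j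
    · rw [hd]
      refine ⟨(stab j).card, ?_⟩
      rw [colAvg_stab_fixed, Nat.cast_smul_eq_nsmul, sub_self]
      exact Ideal.zero_mem _
    · refine ⟨-(((stab j).filter fun τ => τ d = d).card : ℂ), ?_⟩
      rw [colAvg_stab_left hd, neg_smul, sub_neg_eq_add, Nat.cast_smul_eq_nsmul, sub_add_cancel]
      exact nsmul_mem (Ideal.mul_mem_left _ _ (rowSum_mem c)) _
  by_cases hd : d = j
  · rw [hd]
    refine ⟨-(((stab j).filter fun τ => τ b = b).card : ℂ), ?_⟩
    rw [colAvg_stab_right hb, neg_smul, sub_neg_eq_add, Nat.cast_smul_eq_nsmul, sub_add_cancel]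
    exact nsmul_mem (Ideal.mul_mem_left _ _ (rowSum_mem a)) _
  by_cases hbd : b = d
  · rw [← hbd]
    refine ⟨-(((stab j).filter fun τ => τ b = b).card : ℂ), ?_⟩
    rw [colAvg_stab_same hb, neg_smul, sub_neg_eq_add, Nat.cast_smul_eq_nsmul, sub_add_cancel]
    exact nsmul_mem (rowGram_mem a c) _
  -- generic case `j ∉ {b, d}`, `b ≠ d`: average over the free column `d' ∉ {b, j}`
  have hjb : j ∈ Finset.univ.erase b := Finset.mem_erase.2 ⟨Ne.symm hb, Finset.mem_univ _⟩
  have key : ∀ d' ∈ (Finset.univ.erase b).erase j,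
      colAvg (stab j) (X (a, b) * X (c, d')) = colAvg (stab j) (X (a, b) * X (c, d)) := by
    intro d' hd'
    have hd'j : d' ≠ j := (Finset.mem_erase.1 hd').1
    have hd'b : d' ≠ b := (Finset.mem_erase.1 (Finset.mem_erase.1 hd').2).1
    have hswap : rename (Equiv.prodCongr (1 : Perm (Fin m)) (Equiv.swap d d'))
        (X (a, b) * X (c, d) : MvPolynomial (Fin m × Fin m) ℂ) = X (a, b) * X (c, d') := by
      rw [map_mul, rename_one_prodCongr_X, rename_one_prodCongr_X, Equiv.swap_apply_left,
        Equiv.swap_apply_of_ne_of_ne hbd (Ne.symm hd'b)]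
    rw [← hswap, colAvg_stab_rename_eq (Equiv.swap_apply_of_ne_of_ne (Ne.symm hd) (Ne.symm hd'j))]
  -- `A_j(x_{ab} t_c) = A_j(x_{ab} x_{cb}) + (A_j(x_{ab} x_{cj}) + #D • A_j(x_{ab} x_{cd}))`
  have hsum : colAvg (stab j) (X (a, b) * rowSum (Fin m) c) = colAvg (stab j) (X (a, b) * X (c, b)) +
      (colAvg (stab j) (X (a, b) * X (c, j)) +
        ((Finset.univ.erase b).erase j).card • colAvg (stab j) (X (a, b) * X (c, d))) := by
    rw [rowSum, Finset.mul_sum, map_sum, ← Finset.add_sum_erase _ _ (Finset.mem_univ b),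
      ← Finset.add_sum_erase _ _ hjb, Finset.sum_congr rfl key, Finset.sum_const]
  have hD : ((((Finset.univ.erase b).erase j).card : ℕ) : ℂ) ≠ 0 := by
    rw [Nat.cast_ne_zero, Finset.card_erase_of_mem hjb, Finset.card_erase_of_mem (Finset.mem_univ b),
      Finset.card_univ, Fintype.card_fin]
    have h3 := Finset.card_le_univ ({b, d, j} : Finset (Fin m))
    rw [Finset.card_eq_three.2 ⟨b, d, j, hbd, hb, hd, rfl⟩, Fintype.card_fin] at h3
    omega
  obtain ⟨N, hN⟩ : ∃ N : ℕ, ((stab j).filter fun τ => τ b = b).card = N := ⟨_, rfl⟩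
  have h1 := colAvg_stab_same hb a c
  have h2 := colAvg_stab_right hb a c
  rw [hN] at h1 h2
  refine ⟨(((Finset.univ.erase b).erase j).card : ℂ)⁻¹ * (N + N), mem_cheapIdeal_of_smul_mem hD ?_⟩
  -- multiply through by `#D` and use the explicit reductions `h1`, `h2` of the two boundary terms
  have hid : ((Finset.univ.erase b).erase j).card • colAvg (stab j) (X (a, b) * X (c, d)) =
      (colAvg (stab j) (X (a, b) * rowSum (Fin m) c) - N • rowGram (Fin m) a c -
          N • (X (c, j) * rowSum (Fin m) a)) +
        (N • (X (a, j) * X (c, j)) + N • (X (a, j) * X (c, j))) := by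
    rw [hsum, h1, h2]
    abel
  rw [smul_sub, Nat.cast_smul_eq_nsmul, hid, smul_smul, mul_inv_cancel_left₀ hD, add_smul, Nat.cast_smul_eq_nsmul,
    add_sub_cancel_right]
  exact Ideal.sub_mem _ (Ideal.sub_mem _ (colAvg_mul_mem _ _ (rowSum_mem c)) (nsmul_mem (rowGram_mem a c) _))
    (nsmul_mem (Ideal.mul_mem_left _ _ (rowSum_mem a)) _)

/-- `∑_{σ i = i} (σ × 1) · (x_{a,j} x_{c,j}) ∈ 𝔠_m` (transpose of §1: the residue is a multiple of `x_{j,i}²`). -/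
theorem rowAvg_stab_X_mul_X_mem (i j a c : Fin m) :
    rowAvg (stab i) (X (a, j) * X (c, j)) ∈ cheapIdeal (Fin m) := by
  rw [rowAvg_eq_transpose, map_mul, rename_prodComm_X, rename_prodComm_X]
  refine rename_prodComm_mem_cheapIdeal ?_
  obtain ⟨α, hα⟩ := colAvg_stab_X_mul_X i j a j c
  have hsq : α • (X (j, i) * X (j, i) : MvPolynomial (Fin m × Fin m) ℂ) ∈ cheapIdeal (Fin m) :=
    Submodule.smul_of_tower_mem _ α (by rw [← sq]; exact X_sq_mem (j, i))
  have h := Ideal.add_mem _ hα hsq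
  rwa [sub_add_cancel] at h

/-- `B_i A_j (x_{a,b} x_{c,d}) ∈ 𝔠_m`. -/
theorem stabSym_X_mul_X_mem (i j a b c d : Fin m) :
    rowAvg (stab i) (colAvg (stab j) (X (a, b) * X (c, d))) ∈ cheapIdeal (Fin m) := by
  obtain ⟨α, hα⟩ := colAvg_stab_X_mul_X j a b c d
  have h1 := rowAvg_mem (stab i) hα
  rw [map_sub, map_smul] at h1
  have h2 := Ideal.add_mem _ h1 (Submodule.smul_of_tower_mem _ α (rowAvg_stab_X_mul_X_mem i j a c))
  rwa [sub_add_cancel] at h2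

/-- ★ `Σ_{σ i = i} Σ_{τ j = j} (σ × τ) · v ∈ 𝔠` for every quadric `v` and all `i, j`. -/
theorem stabSym_mem_cheapIdeal (i j : Fin m) {v : MvPolynomial (Fin m × Fin m) ℂ} (hv : v.IsHomogeneous 2) :
    ∑ σ ∈ stab i, ∑ τ ∈ stab j, rename (Equiv.prodCongr σ τ) v ∈ cheapIdeal (Fin m) := by
  rw [← rowAvg_colAvg]
  refine Submodule.span_induction (p := fun w _ => rowAvg (stab i) (colAvg (stab j) w) ∈ cheapIdeal (Fin m))
    ?_ ?_ ?_ ?_ (mem_span_X_mul_X hv)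
  · rintro _ ⟨⟨⟨a, b⟩, ⟨c, d⟩⟩, rfl⟩
    exact stabSym_X_mul_X_mem i j a b c d
  · rw [map_zero, map_zero]; exact Ideal.zero_mem _
  · intro x y _ _ hx hy; rw [map_add, map_add]; exact Ideal.add_mem _ hx hy
  · intro r x _ hx; rw [map_smul, map_smul]; exact Submodule.smul_of_tower_mem _ r hx

/-- Packaging of the fixed-point count: `∑_σ #fix(σ) • F σ = ∑_i ∑_{σ i = i} F σ`. -/
theorem sum_fixedCard_smul_eq {M : Type*} [AddCommGroup M] [Module ℂ M] (F : Perm (Fin m) → M) :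
    ∑ σ : Perm (Fin m), ((Finset.univ.filter fun p => σ p = p).card : ℂ) • F σ =
      ∑ i : Fin m, ∑ σ ∈ stab i, F σ := by
  have h : ∀ σ : Perm (Fin m), ((Finset.univ.filter fun p => σ p = p).card : ℂ) • F σ =
      ∑ i : Fin m, if σ i = i then F σ else 0 := fun σ => by
    rw [Finset.natCast_card_filter, Finset.sum_smul]
    refine Finset.sum_congr rfl fun i _ => ?_
    split_ifs <;> simp
  simp_rw [h]
  rw [Finset.sum_comm]
  refine Finset.sum_congr rfl fun i _ => ?_
  rw [stab, Finset.sum_filter]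

/-- `∑_{(σ,τ)} #fix(σ) • F(σ,τ) = ∑_i ∑_{σ i = i} ∑_τ F(σ,τ)` (generic module). -/
theorem sum_fixedCard_fst_smul_eq {M : Type*} [AddCommGroup M] [Module ℂ M] (F : Perm (Fin m) × Perm (Fin m) → M) :
    ∑ t : Perm (Fin m) × Perm (Fin m), ((Finset.univ.filter fun p => t.1 p = p).card : ℂ) • F t =
      ∑ i : Fin m, ∑ σ ∈ stab i, ∑ τ : Perm (Fin m), F (σ, τ) := by
  rw [Fintype.sum_prod_type, ← sum_fixedCard_smul_eq]
  refine Finset.sum_congr rfl fun σ _ => ?_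
  show ∑ τ : Perm (Fin m), ((Finset.univ.filter fun p => σ p = p).card : ℂ) • F (σ, τ) = _
  exact Finset.smul_sum.symm

/-- `∑_{(σ,τ)} #fix(τ) • F(σ,τ) = ∑_j ∑_{τ j = j} ∑_σ F(σ,τ)` (generic module). -/
theorem sum_fixedCard_snd_smul_eq {M : Type*} [AddCommGroup M] [Module ℂ M] (F : Perm (Fin m) × Perm (Fin m) → M) :
    ∑ t : Perm (Fin m) × Perm (Fin m), ((Finset.univ.filter fun p => t.2 p = p).card : ℂ) • F t =
      ∑ j : Fin m, ∑ τ ∈ stab j, ∑ σ : Perm (Fin m), F (σ, τ) := by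
  rw [Fintype.sum_prod_type_right, ← sum_fixedCard_smul_eq]
  refine Finset.sum_congr rfl fun τ _ => ?_
  show ∑ σ : Perm (Fin m), ((Finset.univ.filter fun p => τ p = p).card : ℂ) • F (σ, τ) = _
  exact Finset.smul_sum.symm

/-- `∑_{(σ,τ)} (#fix σ · #fix τ) • F(σ,τ) = ∑_i ∑_{σ i = i} ∑_j ∑_{τ j = j} F(σ,τ)` (generic module). -/
theorem sum_fixedCard_mul_smul_eq {M : Type*} [AddCommGroup M] [Module ℂ M] (F : Perm (Fin m) × Perm (Fin m) → M) :
    ∑ t : Perm (Fin m) × Perm (Fin m), (((Finset.univ.filter fun p => t.1 p = p).card : ℂ) *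
      ((Finset.univ.filter fun p => t.2 p = p).card : ℂ)) • F t =
      ∑ i : Fin m, ∑ σ ∈ stab i, ∑ j : Fin m, ∑ τ ∈ stab j, F (σ, τ) := by
  rw [Fintype.sum_prod_type, ← sum_fixedCard_smul_eq]
  refine Finset.sum_congr rfl fun σ _ => ?_
  rw [← sum_fixedCard_smul_eq]
  show ∑ τ : Perm (Fin m), (((Finset.univ.filter fun p => σ p = p).card : ℂ) *
      ((Finset.univ.filter fun p => τ p = p).card : ℂ)) • F (σ, τ) =
    ((Finset.univ.filter fun p => σ p = p).card : ℂ) •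
      ∑ τ : Perm (Fin m), ((Finset.univ.filter fun p => τ p = p).card : ℂ) • F (σ, τ)
  exact (Finset.sum_congr rfl fun τ _ => mul_smul _ _ _).trans Finset.smul_sum.symm

/-- `Σ_τ (σ × τ) · v = Σ_τ (1 × τ) · ((σ × 1) · v)`. -/
theorem sum_rename_prodCongr_left (σ : Perm (Fin m)) (v : MvPolynomial (Fin m × Fin m) ℂ) :
    ∑ τ : Perm (Fin m), rename (Equiv.prodCongr σ τ) v = ∑ τ : Perm (Fin m),
      rename (Equiv.prodCongr (1 : Perm (Fin m)) τ) (rename (Equiv.prodCongr σ (1 : Perm (Fin m))) v) :=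
  Finset.sum_congr rfl fun τ _ => by
    rw [rename_rename]
    exact congrArg (fun F : Fin m × Fin m → Fin m × Fin m => rename F v) (funext fun ⟨x, y⟩ => rfl)

/-- `Σ_σ (σ × τ) · v = Σ_σ (σ × 1) · ((1 × τ) · v)`. -/
theorem sum_rename_prodCongr_right (τ : Perm (Fin m)) (v : MvPolynomial (Fin m × Fin m) ℂ) :
    ∑ σ : Perm (Fin m), rename (Equiv.prodCongr σ τ) v = ∑ σ : Perm (Fin m),
      rename (Equiv.prodCongr σ (1 : Perm (Fin m))) (rename (Equiv.prodCongr (1 : Perm (Fin m)) τ) v) :=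
  Finset.sum_congr rfl fun σ _ => by
    rw [rename_rename]
    exact congrArg (fun F : Fin m × Fin m → Fin m × Fin m => rename F v) (funext fun ⟨x, y⟩ => rfl)

/-- `∑_{(σ,τ)} (σ × τ) · v ∈ 𝔠_m` (the trivial-type symmetriser). -/
theorem sum_rename_prodCongr_mem_cheapIdeal {v : MvPolynomial (Fin m × Fin m) ℂ} (hv : v.IsHomogeneous 2) :
    ∑ t : Perm (Fin m) × Perm (Fin m), rename (Equiv.prodCongr t.1 t.2) v ∈ cheapIdeal (Fin m) := by
  rw [Fintype.sum_prod_type]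
  try dsimp only
  rw [← rowAvg_colAvg]
  exact rowAvg_mem _ (by rw [colAvg_apply]; exact colSym_mem_cheapIdeal hv)

/-- ★ the `(#fix - 1) ⊠ (#fix - 1)`-weighted double sum of a quadric lies in `𝔠`. -/
theorem sum_fixedCard_smul_rename_mem_cheapIdeal {v : MvPolynomial (Fin m × Fin m) ℂ} (hv : v.IsHomogeneous 2) :
    ∑ t : Perm (Fin m) × Perm (Fin m),
      ((((Finset.univ.filter fun p => t.1 p = p).card : ℂ) - 1) *
        (((Finset.univ.filter fun p => t.2 p = p).card : ℂ) - 1)) •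
        rename (Equiv.prodCongr t.1 t.2) v ∈ cheapIdeal (Fin m) := by
  have hexp : ∀ t : Perm (Fin m) × Perm (Fin m),
      ((((Finset.univ.filter fun p => t.1 p = p).card : ℂ) - 1) *
        (((Finset.univ.filter fun p => t.2 p = p).card : ℂ) - 1)) • rename (Equiv.prodCongr t.1 t.2) v =
      (((Finset.univ.filter fun p => t.1 p = p).card : ℂ) * ((Finset.univ.filter fun p => t.2 p = p).card : ℂ)) •
          rename (Equiv.prodCongr t.1 t.2) v -
        ((Finset.univ.filter fun p => t.1 p = p).card : ℂ) • rename (Equiv.prodCongr t.1 t.2) v -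
        ((Finset.univ.filter fun p => t.2 p = p).card : ℂ) • rename (Equiv.prodCongr t.1 t.2) v +
        rename (Equiv.prodCongr t.1 t.2) v := fun t => by
    rw [show ∀ x y : ℂ, (x - 1) * (y - 1) = x * y - x - y + 1 from fun x y => by ring, add_smul, sub_smul, sub_smul,
      one_smul]
  rw [Finset.sum_congr rfl fun t (_ : t ∈ Finset.univ) => hexp t, Finset.sum_add_distrib, Finset.sum_sub_distrib,
    Finset.sum_sub_distrib]
  -- pieces: `∑_{i,j} StabSym_{ij}(v)`, `∑_i ∑_{σ i = i} ColSym((σ × 1) · v)`, `∑_j ∑_{τ j = j} RowSym((1 × τ) · v)`, trivial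
  refine Ideal.add_mem _ (Ideal.sub_mem _ (Ideal.sub_mem _ ?_ ?_) ?_) (sum_rename_prodCongr_mem_cheapIdeal hv)
  · refine (congrArg (· ∈ cheapIdeal (Fin m)) (sum_fixedCard_mul_smul_eq
      (M := MvPolynomial (Fin m × Fin m) ℂ) fun t => rename (Equiv.prodCongr t.1 t.2) v)).mpr ?_
    refine Ideal.sum_mem _ fun i _ => ?_
    rw [Finset.sum_comm]
    exact Ideal.sum_mem _ fun j _ => stabSym_mem_cheapIdeal i j hv
  · refine (congrArg (· ∈ cheapIdeal (Fin m)) (sum_fixedCard_fst_smul_eq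
      (M := MvPolynomial (Fin m × Fin m) ℂ) fun t => rename (Equiv.prodCongr t.1 t.2) v)).mpr ?_
    refine Ideal.sum_mem _ fun i _ => Ideal.sum_mem _ fun σ _ => ?_
    show ∑ τ : Perm (Fin m), rename (Equiv.prodCongr σ τ) v ∈ cheapIdeal (Fin m)
    rw [sum_rename_prodCongr_left]
    exact colSym_mem_cheapIdeal hv.rename_isHomogeneous
  · refine (congrArg (· ∈ cheapIdeal (Fin m)) (sum_fixedCard_snd_smul_eq
      (M := MvPolynomial (Fin m × Fin m) ℂ) fun t => rename (Equiv.prodCongr t.1 t.2) v)).mpr ?_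
    refine Ideal.sum_mem _ fun j _ => Ideal.sum_mem _ fun τ _ => ?_
    show ∑ σ : Perm (Fin m), rename (Equiv.prodCongr σ τ) v ∈ cheapIdeal (Fin m)
    rw [sum_rename_prodCongr_right]
    exact rowSym_mem_cheapIdeal hv.rename_isHomogeneous

/-- the same with inverses (the shape produced by `isotypicProj_apply`). -/
theorem sum_fixedCard_smul_rename_inv_mem_cheapIdeal {v : MvPolynomial (Fin m × Fin m) ℂ} (hv : v.IsHomogeneous 2) :
    ∑ t : Perm (Fin m) × Perm (Fin m),
      ((((Finset.univ.filter fun p => t.1 p = p).card : ℂ) - 1) *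
        (((Finset.univ.filter fun p => t.2 p = p).card : ℂ) - 1)) •
        rename (Equiv.prodCongr t.1⁻¹ t.2⁻¹) v ∈ cheapIdeal (Fin m) := by
  have hfix : ∀ σ : Perm (Fin m),
      (Finset.univ.filter fun p => σ⁻¹ p = p) = Finset.univ.filter fun p => σ p = p := fun σ => by
    ext p
    simp only [Finset.mem_filter, Finset.mem_univ, true_and]
    rw [Equiv.Perm.inv_eq_iff_eq, eq_comm]
  rw [← (inv_involutive : Function.Involutive (Inv.inv : Perm (Fin m) × Perm (Fin m) → _)).bijective.sum_comp]
  simp only [Prod.fst_inv, Prod.snd_inv, inv_inv, hfix]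
  exact sum_fixedCard_smul_rename_mem_cheapIdeal hv

end Summit.ValiantsHypothesis.ValiantsHypothesis.Theorems.EquivariantDialLayersStabilisers
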